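import Summits.QuantumFields.BalabanUV.T4Continuum.Support.NE3CovariantWeitzenbock
import Summits.QuantumFields.BalabanUV.T4Continuum.Support.NE3FluxGradientDictionary
import HarnessLib

/-!
# NE7CurvedPlaquetteFactorisation — THE PLAQUETTE VARIABLE OF `W·e^{Z}` AT A CURVED BACKGROUND IS A FOUR-FACTOR PRODUCT OF TRANSPORTED EXPONENTIALS
# TIMES THE BACKGROUND PLAQUETTE: `(W e^{Z})(∂p) = e^{X₁}e^{X₂}e^{X₃}e^{X₄}·W(∂p)` with `ΣXᵢ = (d_W Z)(p)` the dressed curl EXACTLY — so the covariant curl of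
# the site-framed field `A = frame W Z` is `[(W e^{Z})(∂p)·W(∂p)⁻¹ − 1] − Rem(X) − curlRem`, the curved twin of lineage #2's (157) §2; file 50

Cell `pub-balaban`, rung (B)+1 sub-cell t4, lineage `b2b-balaban-t4-ne7-p1` (CRUX PROVER NE7 #1 = OWNER of row NE7), generation 79; memo
`t4/b2b-balaban-t4-ne7-p1-g79/GRADIENT-LETTER.md` §2.  File F119 (over `T4AveragingDeficitWall` (`vary`, `curlAt`, `val_hol_vary_plaqWord`, `val_hol_plaqWord`),
`AveragingDeficitCovGrad` (`covFd`, `curlRem`, `curlAt_eq_covFd_sub_add`, `units_id₁`, `units_id₂`), `NE3CovariantCalculus` (`cD`), `NE3CovariantWeitzenbock` (`frame`,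
`cD_frame`), `NE3FluxGradientDictionary.Ad_exp_eq`, `SkeletonPrecompTools.Ad_apply_one`).
WHY.  Lineage #2's (157) `NE7GradientCurrency` reads, at the FLAT background, the linear curl `dA` of `W = e^{A}` as the plaquette deviation `W(∂p) − 1` minus the
second-order remainder `e^{X₁}e^{X₂}e^{X₃}e^{X₄} − 1 − ΣXᵢ`, whose Lipschitz letter (157) §1 `norm_plaqRem_sub_plaqRem_le` lets the remainder's lattice differences be
absorbed into the gradient.  At a CURVED background `W` the representative is `U′ = W·e^{Z}` (E′'s `vary W Z 1`) and the same algebra holds with TRANSPORTED exponents: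
moving the background bonds through the exponentials conjugates them (`exp(Ad_u X) = u·eˣ·u⁻¹`), the four conjugated exponents are exactly the four terms of the
tree's dressed curl `curlAt W Z` (Appendix β (L4)), and the background plaquette `W(∂p)` factors out on the right.  The RELATIVE plaquette deviation
`Q(p) := U′(∂p)·W(∂p)⁻¹ − 1` (site-framed at the base point, gauge covariant) is thus `curlAt + Rem`, and the covariant curl of the site-framed field `A = frame W Z`
(`∇_μ A_ν − ∇_ν A_μ = covFd_{μν} − covFd_{νμ} = curlAt − curlRem`, row NE3-R2) is `Q − Rem − curlRem` — the datum the covariant Hodge identity (F117) and the covariant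
interior gradient estimate (F116) consume in F120 `NE7GradientCurrencyCurved`.
WHAT ([folklore]; 0 def, 0 sorry).  §1 **`Ad_plaqRem`** (transport commutes with the remainder polynomial).  §2 **`hol_vary_one_plaqWord`** (the
factorisation), `curlAt_eq_fourTerms`, **`relPlaq_eq`** (`Q = Πe^{Xᵢ} − 1`), **`curlAt_eq_relPlaq_sub_rem`**.  §3 the site-framed curl: `siteCurl_eq_curlAt_sub_curlRem`,
**`siteCurl_eq_relPlaq_sub`**.  §4 the four exponents through the site-framed field and its covariant differences: `X₁ = A_μ(z)`, `X₂ = A_ν(z) + ∇_μA_ν(z)`,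
`X₃ = −Ad_{W(∂p)}(A_μ(z) + ∇_νA_μ(z))`, `X₄ = −Ad_{W(∂p)}A_ν(z)`; their norms (`= ‖Z‖` at the four bonds, `W` unitary).
HONEST FRAMING (page 1): matrix algebra on OUR lattice objects at ONE configuration; nothing of Bałaban's asserted; no Landau gauge, no minimiser; `α₁^Z`'s gain NOT yet
docked (F120–F121); NOT ONE-STEP, NOT NE7; spine 0∕9; finite T⁴ rung (B)+1 — NOT infinite volume, NOT mass gap, NOT `BetaPertH`, NOT Clay.  Continuum YM on T⁴ ⇐
BetaPertH ∧ nine spine estimates (0/9 proved); BetaPertH ⇐ (D1) ∧ (D4) ∧ CAP+tail; G-an2-4 gates asym, D1 and NE2/3/4.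
-/

set_option autoImplicit false

open scoped BigOperators Matrix Matrix.Norms.L2Operator
open NormedSpace Finset

namespace Summit.QuantumFields.BalabanUV.T4Continuum.NE7CurvedPlaquetteFactorisation

open Literature.MathematicalPhysics.QuantumFieldTheory.Balaban1983to89
open B7Prop1Explicit B7Prop2Explicit
open T4AveragingDeficitWall (Ad IsUnitaryCfg SmallField vary curlAt val_hol_vary_plaqWord val_hol_plaqWord)
open T4AveragingDeficitNonAbelian (Ad_mul Ad_sub)
open AveragingDeficitTransport (norm_Ad_of_unitary)
open AveragingDeficitNearIdentity (Ad_one Ad_add Ad_neg Ad_mul_Ad)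
open AveragingDeficitCovGrad (covFd curlRem curlAt_eq_covFd_sub_add units_id₁ units_id₂ hol_plaqWord_units)
open NE3CovariantCalculus (cD)
open NE3CovariantWeitzenbock (frame cD_frame norm_frame)
open NE3FluxGradientDictionary (Ad_exp_eq)
open SkeletonPrecompTools (Ad_apply_one)

noncomputable section

variable {d : ℕ} {n : Type*} [Fintype n] [DecidableEq n]

/-! ## §1 Transport commutes with the exponential and with the remainder polynomial -/

/-- **TRANSPORT COMMUTES WITH THE PLAQUETTE REMAINDER**: `Ad_u(e^{x₁}e^{x₂}e^{x₃}e^{x₄} − 1 − Σxᵢ) = e^{Ad_u x₁}⋯e^{Ad_u x₄} − 1 − Σ Ad_u xᵢ` (`Ad_u` is an algebra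
automorphism). [folklore] -/
theorem Ad_plaqRem (u : (Matrix n n ℂ)ˣ) (x₁ x₂ x₃ x₄ : Matrix n n ℂ) :
    Ad u (exp x₁ * exp x₂ * exp x₃ * exp x₄ - 1 - (x₁ + x₂ + x₃ + x₄))
      = exp (Ad u x₁) * exp (Ad u x₂) * exp (Ad u x₃) * exp (Ad u x₄) - 1 - (Ad u x₁ + Ad u x₂ + Ad u x₃ + Ad u x₄) := by
  rw [Ad_sub, Ad_sub, Ad_add, Ad_add, Ad_add, Ad_apply_one, ← Ad_exp_eq, ← Ad_exp_eq, ← Ad_exp_eq, ← Ad_exp_eq, Ad_mul_Ad, Ad_mul_Ad, Ad_mul_Ad]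

/-! ## §2 The factorisation of the perturbed plaquette variable and the relative plaquette deviation -/

/-- The dressed curl is the sum of its four transported terms (definitional bookkeeping: `−Ad(⋯)Z = +(−Ad(⋯)Z)`). [folklore] -/
theorem curlAt_eq_fourTerms (W : Site d → Fin d → (Matrix n n ℂ)ˣ) (Z : Site d → Fin d → Matrix n n ℂ) (z : Site d) (μ ν : Fin d) :
    curlAt W Z z μ ν
      = Ad (W z μ) (Z z μ) + Ad (W z μ * W (z + e μ) ν) (Z (z + e μ) ν)
        + -Ad (W z μ * W (z + e μ) ν) (Z (z + e ν) μ) + -Ad (W z μ * W (z + e μ) ν * (W (z + e ν) μ)⁻¹) (Z z ν) := by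
  simp only [curlAt]
  abel

/-- **THE FACTORISATION**: `(W·e^{Z})(∂p) = e^{X₁}·e^{X₂}·e^{X₃}·e^{X₄}·W(∂p)` at `p = (z; μ, ν)` with `X₁ = Ad_{W₁}Z₁`, `X₂ = Ad_{W₁W₂}Z₂`, `X₃ = −Ad_{W₁W₂}Z₃`,
`X₄ = −Ad_{W₁W₂W₃⁻¹}Z₄` (bonds `b₁ = (z,μ)`, `b₂ = (z+e_μ,ν)`, `b₃ = (z+e_ν,μ)`, `b₄ = (z,ν)`). [folklore] -/
theorem hol_vary_one_plaqWord (W : Site d → Fin d → (Matrix n n ℂ)ˣ) (Z : Site d → Fin d → Matrix n n ℂ) (z : Site d) (μ ν : Fin d) :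
    ((hol (vary W Z 1) z (plaqWord μ ν) : (Matrix n n ℂ)ˣ) : Matrix n n ℂ)
      = exp (Ad (W z μ) (Z z μ)) * exp (Ad (W z μ * W (z + e μ) ν) (Z (z + e μ) ν))
        * exp (-Ad (W z μ * W (z + e μ) ν) (Z (z + e ν) μ)) * exp (-Ad (W z μ * W (z + e μ) ν * (W (z + e ν) μ)⁻¹) (Z z ν))
        * ((hol W z (plaqWord μ ν) : (Matrix n n ℂ)ˣ) : Matrix n n ℂ) := by
  rw [val_hol_vary_plaqWord, val_hol_plaqWord, ← Ad_neg, ← Ad_neg, ← Ad_exp_eq, ← Ad_exp_eq, ← Ad_exp_eq, ← Ad_exp_eq]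
  simp only [Complex.ofReal_one, one_smul, Ad, Units.val_mul, mul_inv_rev, inv_inv, mul_assoc,
    Units.inv_mul_cancel_left, Units.mul_inv_cancel_left]

/-- **THE RELATIVE PLAQUETTE DEVIATION IS THE FOUR-FACTOR PRODUCT MINUS ONE**: `(W·e^{Z})(∂p)·W(∂p)⁻¹ − 1 = e^{X₁}e^{X₂}e^{X₃}e^{X₄} − 1`. [folklore] -/
theorem relPlaq_eq (W : Site d → Fin d → (Matrix n n ℂ)ˣ) (Z : Site d → Fin d → Matrix n n ℂ) (z : Site d) (μ ν : Fin d) :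
    ((hol (vary W Z 1) z (plaqWord μ ν) : (Matrix n n ℂ)ˣ) : Matrix n n ℂ) * (((hol W z (plaqWord μ ν))⁻¹ : (Matrix n n ℂ)ˣ) : Matrix n n ℂ) - 1
      = exp (Ad (W z μ) (Z z μ)) * exp (Ad (W z μ * W (z + e μ) ν) (Z (z + e μ) ν))
        * exp (-Ad (W z μ * W (z + e μ) ν) (Z (z + e ν) μ)) * exp (-Ad (W z μ * W (z + e μ) ν * (W (z + e ν) μ)⁻¹) (Z z ν)) - 1 := by
  rw [hol_vary_one_plaqWord, Units.mul_inv_cancel_right]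

/-- **THE DRESSED CURL = RELATIVE PLAQUETTE DEVIATION − REMAINDER**: `curlAt W Z p = [(W e^{Z})(∂p)·W(∂p)⁻¹ − 1] − [e^{X₁}⋯e^{X₄} − 1 − ΣXᵢ]`. [folklore] -/
theorem curlAt_eq_relPlaq_sub_rem (W : Site d → Fin d → (Matrix n n ℂ)ˣ) (Z : Site d → Fin d → Matrix n n ℂ) (z : Site d) (μ ν : Fin d) :
    curlAt W Z z μ ν
      = (((hol (vary W Z 1) z (plaqWord μ ν) : (Matrix n n ℂ)ˣ) : Matrix n n ℂ) * (((hol W z (plaqWord μ ν))⁻¹ : (Matrix n n ℂ)ˣ) : Matrix n n ℂ) - 1)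
        - (exp (Ad (W z μ) (Z z μ)) * exp (Ad (W z μ * W (z + e μ) ν) (Z (z + e μ) ν))
            * exp (-Ad (W z μ * W (z + e μ) ν) (Z (z + e ν) μ)) * exp (-Ad (W z μ * W (z + e μ) ν * (W (z + e ν) μ)⁻¹) (Z z ν)) - 1
          - (Ad (W z μ) (Z z μ) + Ad (W z μ * W (z + e μ) ν) (Z (z + e μ) ν)
              + -Ad (W z μ * W (z + e μ) ν) (Z (z + e ν) μ) + -Ad (W z μ * W (z + e μ) ν * (W (z + e ν) μ)⁻¹) (Z z ν))) := by
  rw [relPlaq_eq, curlAt_eq_fourTerms]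
  abel

/-! ## §3 The covariant curl of the site-framed field `A = frame W Z` -/

/-- The site-framed covariant curl `∇_μ A_ν − ∇_ν A_μ` of `A = frame W Z` is `covFd_{μν} − covFd_{νμ} = curlAt − curlRem`. [folklore] -/
theorem siteCurl_eq_curlAt_sub_curlRem (W : Site d → Fin d → (Matrix n n ℂ)ˣ) (Z : Site d → Fin d → Matrix n n ℂ) (z : Site d) (μ ν : Fin d) :
    cD W μ (fun y => frame W Z y ν) z - cD W ν (fun y => frame W Z y μ) z = curlAt W Z z μ ν - curlRem W Z z μ ν := by
  rw [cD_frame, cD_frame, curlAt_eq_covFd_sub_add]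
  abel

/-- **THE COVARIANT CURL OF THE SITE-FRAMED FIELD AS DATUM MINUS REMAINDERS**:
`∇_μ A_ν − ∇_ν A_μ = [(W e^{Z})(∂p)·W(∂p)⁻¹ − 1] − [e^{X₁}⋯e^{X₄} − 1 − ΣXᵢ] − curlRem W Z p`. [folklore] -/
theorem siteCurl_eq_relPlaq_sub (W : Site d → Fin d → (Matrix n n ℂ)ˣ) (Z : Site d → Fin d → Matrix n n ℂ) (z : Site d) (μ ν : Fin d) :
    cD W μ (fun y => frame W Z y ν) z - cD W ν (fun y => frame W Z y μ) z
      = (((hol (vary W Z 1) z (plaqWord μ ν) : (Matrix n n ℂ)ˣ) : Matrix n n ℂ) * (((hol W z (plaqWord μ ν))⁻¹ : (Matrix n n ℂ)ˣ) : Matrix n n ℂ) - 1)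
        - (exp (Ad (W z μ) (Z z μ)) * exp (Ad (W z μ * W (z + e μ) ν) (Z (z + e μ) ν))
            * exp (-Ad (W z μ * W (z + e μ) ν) (Z (z + e ν) μ)) * exp (-Ad (W z μ * W (z + e μ) ν * (W (z + e ν) μ)⁻¹) (Z z ν)) - 1
          - (Ad (W z μ) (Z z μ) + Ad (W z μ * W (z + e μ) ν) (Z (z + e μ) ν)
              + -Ad (W z μ * W (z + e μ) ν) (Z (z + e ν) μ) + -Ad (W z μ * W (z + e μ) ν * (W (z + e ν) μ)⁻¹) (Z z ν)))
        - curlRem W Z z μ ν := by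
  rw [siteCurl_eq_curlAt_sub_curlRem, curlAt_eq_relPlaq_sub_rem]

/-! ## §4 The four exponents through the site-framed field and its covariant differences -/

/-- `X₁ = A_μ(z)`. [folklore] -/
theorem X₁_eq (W : Site d → Fin d → (Matrix n n ℂ)ˣ) (Z : Site d → Fin d → Matrix n n ℂ) (z : Site d) (μ : Fin d) :
    Ad (W z μ) (Z z μ) = frame W Z z μ := rfl

/-- `X₂ = A_ν(z) + ∇_μ A_ν(z)` (`= Ad_{W(z,μ)} A_ν(z+e_μ)`). [folklore] -/
theorem X₂_eq (W : Site d → Fin d → (Matrix n n ℂ)ˣ) (Z : Site d → Fin d → Matrix n n ℂ) (z : Site d) (μ ν : Fin d) :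
    Ad (W z μ * W (z + e μ) ν) (Z (z + e μ) ν) = frame W Z z ν + cD W μ (fun y => frame W Z y ν) z := by
  simp only [cD, frame, Ad_mul]
  abel

/-- `X₃ = −Ad_{W(∂p)}(A_μ(z) + ∇_ν A_μ(z))` (`W₁W₂ = W(∂p)·W₄W₃`). [folklore] -/
theorem X₃_eq (W : Site d → Fin d → (Matrix n n ℂ)ˣ) (Z : Site d → Fin d → Matrix n n ℂ) (z : Site d) (μ ν : Fin d) :
    -Ad (W z μ * W (z + e μ) ν) (Z (z + e ν) μ)
      = -Ad (hol W z (plaqWord μ ν)) (frame W Z z μ + cD W ν (fun y => frame W Z y μ) z) := by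
  have h : W z μ * W (z + e μ) ν = hol W z (plaqWord μ ν) * (W z ν * W (z + e ν) μ) := by
    rw [units_id₁ W z μ ν]; group
  rw [h]
  simp only [cD, frame, Ad_mul, add_sub_cancel]

/-- `X₄ = −Ad_{W(∂p)} A_ν(z)` (`W₁W₂W₃⁻¹ = W(∂p)·W₄`). [folklore] -/
theorem X₄_eq (W : Site d → Fin d → (Matrix n n ℂ)ˣ) (Z : Site d → Fin d → Matrix n n ℂ) (z : Site d) (μ ν : Fin d) :
    -Ad (W z μ * W (z + e μ) ν * (W (z + e ν) μ)⁻¹) (Z z ν) = -Ad (hol W z (plaqWord μ ν)) (frame W Z z ν) := by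
  rw [units_id₂ W z μ ν, Ad_mul]
  rfl

/-- The transported value `Ad_{W(z,ν)} A_μ(z+e_ν) = A_μ(z) + ∇_ν A_μ(z)` has the norm of `Z(z+e_ν, μ)` (unitary `W`). [folklore] -/
theorem norm_frame_add_cD [Nonempty n] {W : Site d → Fin d → (Matrix n n ℂ)ˣ} (hW : IsUnitaryCfg W) (Z : Site d → Fin d → Matrix n n ℂ)
    (z : Site d) (μ ν : Fin d) : ‖frame W Z z μ + cD W ν (fun y => frame W Z y μ) z‖ = ‖Z (z + e ν) μ‖ := by
  have h : frame W Z z μ + cD W ν (fun y => frame W Z y μ) z = Ad (W z ν * W (z + e ν) μ) (Z (z + e ν) μ) := by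
    simp only [cD, frame, Ad_mul, add_sub_cancel]
  rw [h, norm_Ad_of_unitary ((unitaryUnits _).mul_mem (hW _ _) (hW _ _))]

/-- The four exponents have the norms of `Z` at the four bonds of `∂p` (unitary `W`). [folklore] -/
theorem norm_fourTerms [Nonempty n] {W : Site d → Fin d → (Matrix n n ℂ)ˣ} (hW : IsUnitaryCfg W) (Z : Site d → Fin d → Matrix n n ℂ)
    (z : Site d) (μ ν : Fin d) :
    ‖Ad (W z μ) (Z z μ)‖ = ‖Z z μ‖ ∧ ‖Ad (W z μ * W (z + e μ) ν) (Z (z + e μ) ν)‖ = ‖Z (z + e μ) ν‖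
      ∧ ‖-Ad (W z μ * W (z + e μ) ν) (Z (z + e ν) μ)‖ = ‖Z (z + e ν) μ‖
      ∧ ‖-Ad (W z μ * W (z + e μ) ν * (W (z + e ν) μ)⁻¹) (Z z ν)‖ = ‖Z z ν‖ := by
  have h12 : W z μ * W (z + e μ) ν ∈ unitaryUnits (Matrix n n ℂ) := (unitaryUnits _).mul_mem (hW _ _) (hW _ _)
  refine ⟨norm_Ad_of_unitary (hW _ _) _, norm_Ad_of_unitary h12 _, ?_, ?_⟩
  · rw [norm_neg, norm_Ad_of_unitary h12]
  · rw [norm_neg, norm_Ad_of_unitary ((unitaryUnits _).mul_mem h12 ((unitaryUnits _).inv_mem (hW _ _)))]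

end

end Summit.QuantumFields.BalabanUV.T4Continuum.NE7CurvedPlaquetteFactorisation
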